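import Mathlib
import HarnessLib
import Literature.MathematicalPhysics.QuantumLattice.GaugeGroups
import Literature.LinearAlgebra.Matrix.UnitaryGroupMaximalTorus
import Literature.LinearAlgebra.Matrix.SpecialUnitaryGroupConjugacyClasses
import Literature.RepresentationTheory.CompactGroups.WeylIntegralFormula
import Summits.Ventures.LatticeQCDFlow.Exactness.CompactHaar
import Summits.Ventures.LatticeQCDFlow.Exactness.SU2A0Marginal
import Summits.Ventures.LatticeQCDFlow.Exactness.SpectralKernelJacobianWeylShapeSU
import Summits.Ventures.LatticeQCDFlow.Exactness.TorusCircleChart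
import Summits.Ventures.LatticeQCDFlow.Exactness.SU2TorusAlcoveJacobian
import Summits.Ventures.LatticeQCDFlow.Exactness.ConjugationMass
import Summits.QuantumFields.YangMills.Theorems.FradkinShenkerFlowFiniteSusceptibilityWeakCouplingSU2ConjugationEven

/-!
# Weyl's integral formula for `SU(2)`, proved: conjugation pushes `Haar_{SU(2)} ⊗ (|Δ|²/2)·Haar_{SΔ(2)}` forward to `Haar_{SU(2)}`

HONEST FRAMING: exact (Metropolis-corrected) sampling algorithms for lattice gauge theory;
figures of merit are autocorrelation/cost numbers at stated couplings and volumes; no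
continuum-physics claim.

Venture `LatticeQCDFlow` (cell pub-lqcd), topic `Exactness`; FANOUT row 10 (`eng-equiv`, engine
`latflow.equiv` / `latflow.flows_jax`, `spectral.py`: the `SU(2)` spectral kernel books the
Haar/Vandermonde factor `log|Δ(θ')|² − log|Δ(θ)|²`, whose justification is Weyl's integral
formula).  NEW WORK of the cell — a PROOF, for `n = Fin 2`, of the tree's NAMED FACT
`Literature.RepresentationTheory.CompactGroups.weylIntegralFormula_specialUnitary`
([BrockerTomDieck1985, IV (1.11)], recorded there unproved) — over Mathlib, row 9's
`SU2A0Marginal.map_su2a0_haarProbability` (the `a₀ = Re tr/2` marginal of `Haar_{SU(2)}` is the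
semicircle law), `CompactHaar.lean` (Haar on a compact group is two-sided invariant), the
Literature torus files (`exists_conj_mem_specialDiagonalTorus`) and this row's
`SU2TorusAlcoveJacobian.haarProbability_su2Torus_eq_alcoves` (Haar on `SΔ(2)` by Weyl chambers);
the Weyl element `[[0,1],[−1,0]] ∈ SU(2)` is reused from the YangMills summit
(`FiniteSusceptibilityWeakCoupling.SU2ConjugationEven.J_mem`).
No Lie theory and no sphere: the proof is conjugation-class averaging inside `SU(2)`.  Nothing is
cited as a fact; no number; no definition.

## The argument (for a Borel set `A ⊆ SU(2)`; `κ_A(U) = Haar{g | g U g⁻¹ ∈ A}`)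

* `κ_A` is a class function (right invariance of Haar) and `Haar(A) = ∫ κ_A(U) dHaar(U)`
  (conjugation invariance + Tonelli);
* every `U` is conjugate to the alcove point `diag(e^{ia}, e^{−ia})`, `a = arccos a₀(U) ∈ [0, π]`
  (unitary diagonalisation + the Weyl swap), so `κ_A(U) = K_A(a₀ U)` and
  `Haar(A) = ∫ K_A d(semicircle law) = ∫_{[0,π]} (2/π) sin²a · κ_A(diag(e^{ia}, e^{−ia})) da` (`x = cos a`);
* the left side `∫_{SΔ(2)} |Δ(t)|²/2 · κ_A(t) dHaar_T` is the same integral, chamber by chamber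
  (`|Δ(diag(e^{±ia}, e^{∓ia}))|²/2 = 2 sin²a`, `Haar_T = (2π)⁻¹(E₊ + E₋)_* Leb|_[0,π]`).

## What is typed

* (`ConjugationMass.lean`: `κ_A` is measurable, a class function, and `Haar A = ∫ κ_A dHaar` on
  any compact second-countable group);
* `SU(2)`: `su2TorusChart_inv_eq_weyl_conj` (the Weyl swap
  `diag(z,z⁻¹) ↦ diag(z⁻¹,z)` is a conjugation in `SU(2)`), `su2a0_conj`, `su2a0_su2TorusChart_exp`
  (`a₀ = cos a`), **`conjMass_eq_conjMass_alcove`** (`κ_A(U) = κ_A(diag(e^{ia}, e^{−ia}))`,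
  `a = arccos a₀(U)`), `norm_exp_sub_exp_inv` / `vandermondeWeight_su2TorusChart_exp`
  (`|Δ|²/2 = 2 sin²a` on both chambers);
* **`haar_apply_eq_lintegral_alcove`**, **`weylPushforward_apply_eq_lintegral_alcove`** (both
  sides as `∫_{[0,π]} (2/π) sin²a · κ_A da`);
* **`weylIntegralFormula_specialUnitary_fin_two : weylIntegralFormula_specialUnitary (Fin 2)`**.

Consequence (row 10): for `N = 2` the hypothesis `hW` of
`hasJacobian_spectralKernel_specialUnitaryGroup_of_weyl[Fact]` is a theorem; with
`SU2TorusAlcoveJacobian.lean` (`hfJ`) the `SU(2)` spectral coupling layer's exactness becomes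
unconditional.

NOT here: `U(2)`; `n ≥ 3` (the general Weyl formula needs the Jacobian of `G/T × T → G`).
-/

noncomputable section

namespace Summit.Ventures.LatticeQCDFlow.Exactness

open MeasureTheory Matrix Topology Set Real
open Literature.LinearAlgebra.Matrix
open Literature.MathematicalPhysics.QuantumFieldTheory (haarProbability)
open Literature.RepresentationTheory.CompactGroups
open Summit.QuantumFields.YangMills.Theorems.FiniteSusceptibilityWeakCoupling.SU2ConjugationEven (J_mem)
open scoped ENNReal

/-! ## `SU(2)`: every element is conjugate to an alcove point -/

section SU2

/-- `a₀` is a class function: `a₀(h U h⁻¹) = a₀(U)`. -/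
theorem su2a0_conj (U h : Matrix.specialUnitaryGroup (Fin 2) ℂ) : su2a0 (h * U * h⁻¹) = su2a0 U := by
  unfold su2a0
  have hmul : (((h * U * h⁻¹ : Matrix.specialUnitaryGroup (Fin 2) ℂ)) : Matrix (Fin 2) (Fin 2) ℂ) =
      (h : Matrix (Fin 2) (Fin 2) ℂ) * (U : Matrix (Fin 2) (Fin 2) ℂ) * star (h : Matrix (Fin 2) (Fin 2) ℂ) := rfl
  rw [hmul, Matrix.trace_mul_cycle,
    Matrix.mem_unitaryGroup_iff'.mp (Matrix.mem_specialUnitaryGroup_iff.mp h.2).1, one_mul]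

/-- `e^{ia} − e^{−ia} = 2 sin a · i`. -/
theorem coe_exp_sub_coe_exp_inv (a : ℝ) :
    (Circle.exp a : ℂ) - ((Circle.exp a)⁻¹ : Circle) = ((2 * Real.sin a : ℝ) : ℂ) * Complex.I := by
  rw [← Circle.exp_neg, Circle.coe_exp, Circle.coe_exp, Complex.exp_mul_I, Complex.ofReal_neg,
    Complex.exp_mul_I, Complex.cos_neg, Complex.sin_neg]
  push_cast
  ring

/-- `‖e^{ia} − e^{−ia}‖ = 2 |sin a|`. -/
theorem norm_exp_sub_exp_inv (a : ℝ) :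
    ‖(Circle.exp a : ℂ) - ((Circle.exp a)⁻¹ : Circle)‖ = 2 * |Real.sin a| := by
  rw [coe_exp_sub_coe_exp_inv, norm_mul, Complex.norm_I, mul_one, Complex.norm_real, Real.norm_eq_abs,
    abs_mul, abs_of_pos (by norm_num : (0 : ℝ) < 2)]

variable {c : Circle → specialDiagonalTorus (Fin 2)}
  (hc : ∀ z, (((c z : specialDiagonalTorus (Fin 2)) : Matrix.specialUnitaryGroup (Fin 2) ℂ) :
    Matrix (Fin 2) (Fin 2) ℂ) = diagonal ![(z : ℂ), ((z⁻¹ : Circle) : ℂ)])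

include hc

/-- **The Weyl swap is a conjugation**: `diag(z⁻¹, z) = w · diag(z, z⁻¹) · w⁻¹` in `SU(2)`. -/
theorem su2TorusChart_inv_eq_weyl_conj (z : Circle) :
    ((c z⁻¹ : specialDiagonalTorus (Fin 2)) : Matrix.specialUnitaryGroup (Fin 2) ℂ) =
      ⟨!![(0 : ℂ), 1; -1, 0], J_mem⟩ * (c z : Matrix.specialUnitaryGroup (Fin 2) ℂ) *
        ⟨!![(0 : ℂ), 1; -1, 0], J_mem⟩⁻¹ := by
  apply Subtype.ext
  change (((c z⁻¹ : specialDiagonalTorus (Fin 2)) : Matrix.specialUnitaryGroup (Fin 2) ℂ) :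
      Matrix (Fin 2) (Fin 2) ℂ) =
    !![(0 : ℂ), 1; -1, 0] * (((c z : specialDiagonalTorus (Fin 2)) : Matrix.specialUnitaryGroup (Fin 2) ℂ) :
      Matrix (Fin 2) (Fin 2) ℂ) * star !![(0 : ℂ), 1; -1, 0]
  have hstar : star !![(0 : ℂ), 1; -1, 0] = !![(0 : ℂ), -1; 1, 0] := by
    ext i j
    fin_cases i <;> fin_cases j <;> simp [Matrix.star_apply]
  have hd : ∀ u v : ℂ, diagonal ![u, v] = !![u, 0; 0, v] := fun u v => by
    ext i j
    fin_cases i <;> fin_cases j <;> simp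
  rw [hc, hc, inv_inv, hstar, hd, hd, Matrix.mul_fin_two, Matrix.mul_fin_two]
  ext i j
  fin_cases i <;> fin_cases j <;> simp

/-- On the alcove chart `a₀(diag(e^{ia}, e^{−ia})) = cos a`. -/
theorem su2a0_su2TorusChart_exp (a : ℝ) :
    su2a0 ((c (Circle.exp a) : specialDiagonalTorus (Fin 2)) : Matrix.specialUnitaryGroup (Fin 2) ℂ) =
      Real.cos a := by
  unfold su2a0
  rw [hc, Matrix.trace_fin_two, diagonal_apply_eq, diagonal_apply_eq, Matrix.cons_val_zero,
    Matrix.cons_val_one, Matrix.cons_val_zero, Circle.coe_inv_eq_conj, Complex.add_re, Complex.conj_re,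
    Circle.coe_exp, Complex.exp_ofReal_mul_I_re]
  ring

/-- **Every `U ∈ SU(2)` is conjugate to the alcove point `diag(e^{ia}, e^{−ia})`, `a = arccos a₀(U)`**,
at the level of conjugation masses: `κ_A(U) = κ_A(diag(e^{ia}, e^{−ia}))`. -/
theorem conjMass_eq_conjMass_alcove {A : Set (Matrix.specialUnitaryGroup (Fin 2) ℂ)} (hA : MeasurableSet A)
    (U : Matrix.specialUnitaryGroup (Fin 2) ℂ) :
    haarProbability (Matrix.specialUnitaryGroup (Fin 2) ℂ)
        {g : Matrix.specialUnitaryGroup (Fin 2) ℂ | g * U * g⁻¹ ∈ A} =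
      haarProbability (Matrix.specialUnitaryGroup (Fin 2) ℂ)
        {g : Matrix.specialUnitaryGroup (Fin 2) ℂ |
          g * ((c (Circle.exp (Real.arccos (su2a0 U))) : specialDiagonalTorus (Fin 2)) :
            Matrix.specialUnitaryGroup (Fin 2) ℂ) * g⁻¹ ∈ A} := by
  -- diagonalise: `U = V t V⁻¹`, `t = c z`, `z = e^{iφ}`, `φ = arg z ∈ (−π, π]`
  obtain ⟨V, hV⟩ := exists_conj_mem_specialDiagonalTorus U
  obtain ⟨z, hz⟩ := (su2TorusChart_surjective_continuous hc).1 ⟨V⁻¹ * U * V, hV⟩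
  have hzU : ((c z : specialDiagonalTorus (Fin 2)) : Matrix.specialUnitaryGroup (Fin 2) ℂ) = V⁻¹ * U * V :=
    congrArg Subtype.val hz
  have hU : U = V * ((c z : specialDiagonalTorus (Fin 2)) : Matrix.specialUnitaryGroup (Fin 2) ℂ) * V⁻¹ := by
    rw [hzU]; group
  set φ : ℝ := Complex.arg (z : ℂ) with hφ
  have hzφ : Circle.exp φ = z := Circle.exp_arg z
  have ha0 : su2a0 U = Real.cos φ := by
    rw [hU, su2a0_conj, ← hzφ, su2a0_su2TorusChart_exp hc]
  have hφ2 : φ ≤ π := Complex.arg_le_pi _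
  have hφ1 : -π < φ := Complex.neg_pi_lt_arg _
  rw [ha0, hU, conjMass_conj hA]
  by_cases hφ0 : 0 ≤ φ
  · rw [Real.arccos_cos hφ0 hφ2, hzφ]
  · have hφ0' : φ < 0 := lt_of_not_ge hφ0
    have h1 : Real.arccos (Real.cos φ) = -φ := by
      rw [← Real.cos_neg, Real.arccos_cos (by linarith) (by linarith)]
    rw [h1, Circle.exp_neg, hzφ, su2TorusChart_inv_eq_weyl_conj hc, conjMass_conj hA]

/-- **The Vandermonde weight on the chambers**: `(∏_i ∏_{j≠i} |t_ii − t_jj|)/2! = 2 sin²a` at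
`t = diag(e^{ia}, e^{−ia})` — the weight exactly as written in `weylIntegralFormula_specialUnitary (Fin 2)`. -/
theorem vandermondeWeight_su2TorusChart_exp (a : ℝ) :
    (∏ i, ∏ j ∈ Finset.univ.erase i,
        ‖(((c (Circle.exp a) : specialDiagonalTorus (Fin 2)) : Matrix.specialUnitaryGroup (Fin 2) ℂ) :
            Matrix (Fin 2) (Fin 2) ℂ) i i -
          (((c (Circle.exp a) : specialDiagonalTorus (Fin 2)) : Matrix.specialUnitaryGroup (Fin 2) ℂ) :
            Matrix (Fin 2) (Fin 2) ℂ) j j‖) / (Fintype.card (Fin 2)).factorial = 2 * Real.sin a ^ 2 := by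
  have h0 : (Finset.univ.erase (0 : Fin 2)) = {1} := by decide
  have h1 : (Finset.univ.erase (1 : Fin 2)) = {0} := by decide
  rw [Fin.prod_univ_two, h0, h1, Finset.prod_singleton, Finset.prod_singleton, hc, diagonal_apply_eq,
    diagonal_apply_eq, Matrix.cons_val_zero, Matrix.cons_val_one, Matrix.cons_val_zero, norm_sub_rev
      (((Circle.exp a)⁻¹ : Circle) : ℂ), norm_exp_sub_exp_inv, Fintype.card_fin, Nat.factorial_two]
  push_cast
  rw [show (2 * |Real.sin a|) * (2 * |Real.sin a|) = 4 * (|Real.sin a| * |Real.sin a|) by ring, abs_mul_abs_self]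
  ring

/-- **The right side: `Haar_{SU(2)}(A)` as an alcove integral**,
`Haar(A) = ∫_{[0,π]} (2/π) sin²a · κ_A(diag(e^{ia}, e^{−ia})) da`. -/
theorem haar_apply_eq_lintegral_alcove {A : Set (Matrix.specialUnitaryGroup (Fin 2) ℂ)} (hA : MeasurableSet A) :
    haarProbability (Matrix.specialUnitaryGroup (Fin 2) ℂ) A =
      ∫⁻ a in Icc 0 π, ENNReal.ofReal (2 / π * Real.sin a ^ 2) *
        haarProbability (Matrix.specialUnitaryGroup (Fin 2) ℂ)
          {g : Matrix.specialUnitaryGroup (Fin 2) ℂ |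
            g * ((c (Circle.exp a) : specialDiagonalTorus (Fin 2)) : Matrix.specialUnitaryGroup (Fin 2) ℂ) *
              g⁻¹ ∈ A} := by
  set μ := haarProbability (Matrix.specialUnitaryGroup (Fin 2) ℂ) with hμ
  set κ : Matrix.specialUnitaryGroup (Fin 2) ℂ → ℝ≥0∞ := fun U => μ {g | g * U * g⁻¹ ∈ A} with hκ
  have hκm : Measurable κ := measurable_conjMass hA
  -- `K x = κ (c e^{i arccos x})`
  have hcm : Continuous fun x : ℝ =>
      ((c (Circle.exp (Real.arccos x)) : specialDiagonalTorus (Fin 2)) : Matrix.specialUnitaryGroup (Fin 2) ℂ) :=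
    continuous_subtype_val.comp ((su2TorusChart_surjective_continuous hc).2.comp
      (Circle.exp.continuous.comp Real.continuous_arccos))
  have hKm : Measurable fun x : ℝ =>
      κ ((c (Circle.exp (Real.arccos x)) : specialDiagonalTorus (Fin 2)) : Matrix.specialUnitaryGroup (Fin 2) ℂ) :=
    hκm.comp hcm.measurable
  have hsdm : Measurable fun x : ℝ => ENNReal.ofReal (semicircleDensity x) :=
    ENNReal.measurable_ofReal.comp continuous_semicircleDensity.measurable
  calc μ A = ∫⁻ U, κ U ∂μ := haar_eq_lintegral_conjMass hA
    _ = ∫⁻ U, κ ((c (Circle.exp (Real.arccos (su2a0 U))) : specialDiagonalTorus (Fin 2)) :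
          Matrix.specialUnitaryGroup (Fin 2) ℂ) ∂μ :=
        lintegral_congr fun U => conjMass_eq_conjMass_alcove hc hA U
    _ = ∫⁻ x, κ ((c (Circle.exp (Real.arccos x)) : specialDiagonalTorus (Fin 2)) :
          Matrix.specialUnitaryGroup (Fin 2) ℂ) ∂(μ.map su2a0) :=
        (lintegral_map hKm continuous_su2a0.measurable).symm
    _ = ∫⁻ x, κ ((c (Circle.exp (Real.arccos x)) : specialDiagonalTorus (Fin 2)) :
          Matrix.specialUnitaryGroup (Fin 2) ℂ) ∂semicircleLaw := by rw [hμ, map_su2a0_haarProbability]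
    _ = ∫⁻ x, ENNReal.ofReal (semicircleDensity x) *
          κ ((c (Circle.exp (Real.arccos x)) : specialDiagonalTorus (Fin 2)) :
            Matrix.specialUnitaryGroup (Fin 2) ℂ) ∂volume := by
        rw [semicircleLaw, lintegral_withDensity_eq_lintegral_mul _ hsdm hKm]
        rfl
    _ = ∫⁻ x in Icc (-1 : ℝ) 1, ENNReal.ofReal (semicircleDensity x) *
          κ ((c (Circle.exp (Real.arccos x)) : specialDiagonalTorus (Fin 2)) :
            Matrix.specialUnitaryGroup (Fin 2) ℂ) := by
        rw [← lintegral_add_compl _ (measurableSet_Icc : MeasurableSet (Icc (-1 : ℝ) 1))]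
        have h0 : ∫⁻ x in (Icc (-1 : ℝ) 1)ᶜ, ENNReal.ofReal (semicircleDensity x) *
            κ ((c (Circle.exp (Real.arccos x)) : specialDiagonalTorus (Fin 2)) :
              Matrix.specialUnitaryGroup (Fin 2) ℂ) = 0 := by
          rw [setLIntegral_congr_fun measurableSet_Icc.compl (fun x hx => by
            rw [semicircleDensity_eq_zero hx, ENNReal.ofReal_zero, zero_mul]), lintegral_zero]
        rw [h0, add_zero]
    _ = ∫⁻ x in Real.cos '' Icc 0 π, ENNReal.ofReal (semicircleDensity x) *
          κ ((c (Circle.exp (Real.arccos x)) : specialDiagonalTorus (Fin 2)) :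
            Matrix.specialUnitaryGroup (Fin 2) ℂ) := by rw [Real.bijOn_cos.image_eq]
    _ = ∫⁻ a in Icc 0 π, ENNReal.ofReal (-(-Real.sin a)) * (ENNReal.ofReal (semicircleDensity (Real.cos a)) *
          κ ((c (Circle.exp (Real.arccos (Real.cos a))) : specialDiagonalTorus (Fin 2)) :
            Matrix.specialUnitaryGroup (Fin 2) ℂ)) :=
        lintegral_image_eq_lintegral_deriv_mul_of_antitoneOn measurableSet_Icc
          (fun a _ => (Real.hasDerivAt_cos a).hasDerivWithinAt) Real.strictAntiOn_cos.antitoneOn _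
    _ = ∫⁻ a in Icc 0 π, ENNReal.ofReal (2 / π * Real.sin a ^ 2) *
          κ ((c (Circle.exp a) : specialDiagonalTorus (Fin 2)) : Matrix.specialUnitaryGroup (Fin 2) ℂ) := by
        refine setLIntegral_congr_fun measurableSet_Icc fun a ha => ?_
        have hsin : 0 ≤ Real.sin a := Real.sin_nonneg_of_nonneg_of_le_pi ha.1 ha.2
        have hsd : semicircleDensity (Real.cos a) = 2 / π * Real.sin a := by
          rw [semicircleDensity, Real.cos_sq', show 1 - (1 - Real.sin a ^ 2) = Real.sin a ^ 2 by ring,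
            Real.sqrt_sq hsin]
        rw [neg_neg, Real.arccos_cos ha.1 ha.2, hsd, ← mul_assoc, ← ENNReal.ofReal_mul hsin]
        congr 2
        ring

/-- **The left side: the Weyl pushforward of `A` as the same alcove integral.**  For the
conjugation map and the Vandermonde-weighted torus measure exactly as in
`weylIntegralFormula_specialUnitary (Fin 2)`:
`(conj_* (Haar ⊗ (|Δ|²/2)·Haar_T))(A) = ∫_{[0,π]} (2/π) sin²a · κ_A(diag(e^{ia}, e^{−ia})) da`. -/
theorem weylPushforward_apply_eq_lintegral_alcove {A : Set (Matrix.specialUnitaryGroup (Fin 2) ℂ)}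
    (hA : MeasurableSet A) :
    Measure.map (fun q : Matrix.specialUnitaryGroup (Fin 2) ℂ × specialDiagonalTorus (Fin 2) =>
        q.1 * (q.2 : Matrix.specialUnitaryGroup (Fin 2) ℂ) * q.1⁻¹)
      ((haarProbability (Matrix.specialUnitaryGroup (Fin 2) ℂ)).prod
        ((haarProbability (specialDiagonalTorus (Fin 2))).withDensity fun t => ENNReal.ofReal
          ((∏ i, ∏ j ∈ Finset.univ.erase i,
            ‖((t : Matrix.specialUnitaryGroup (Fin 2) ℂ) : Matrix (Fin 2) (Fin 2) ℂ) i i -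
              ((t : Matrix.specialUnitaryGroup (Fin 2) ℂ) : Matrix (Fin 2) (Fin 2) ℂ) j j‖) /
                (Fintype.card (Fin 2)).factorial))) A =
      ∫⁻ a in Icc 0 π, ENNReal.ofReal (2 / π * Real.sin a ^ 2) *
        haarProbability (Matrix.specialUnitaryGroup (Fin 2) ℂ)
          {g : Matrix.specialUnitaryGroup (Fin 2) ℂ |
            g * ((c (Circle.exp a) : specialDiagonalTorus (Fin 2)) : Matrix.specialUnitaryGroup (Fin 2) ℂ) *
              g⁻¹ ∈ A} := by
  haveI : SecondCountableTopology (specialDiagonalTorus (Fin 2)) := secondCountableTopology_specialDiagonalTorus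
  set μ := haarProbability (Matrix.specialUnitaryGroup (Fin 2) ℂ) with hμ
  set κ : Matrix.specialUnitaryGroup (Fin 2) ℂ → ℝ≥0∞ := fun U => μ {g | g * U * g⁻¹ ∈ A} with hκ
  have hκm : Measurable κ := measurable_conjMass hA
  set D : specialDiagonalTorus (Fin 2) → ℝ≥0∞ := fun t => ENNReal.ofReal
    ((∏ i, ∏ j ∈ Finset.univ.erase i,
      ‖((t : Matrix.specialUnitaryGroup (Fin 2) ℂ) : Matrix (Fin 2) (Fin 2) ℂ) i i -
        ((t : Matrix.specialUnitaryGroup (Fin 2) ℂ) : Matrix (Fin 2) (Fin 2) ℂ) j j‖) /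
          (Fintype.card (Fin 2)).factorial) with hD
  have hDm : Measurable D := measurable_vandermondeWeight_special
  have hΦ := (measurable_conjChart_special (n := Fin 2))
  have hcm : Measurable c := (su2TorusChart_surjective_continuous hc).2.measurable
  have hem : Measurable fun θ : ℝ => Circle.exp θ := Circle.exp.continuous.measurable
  have hce : Measurable fun a : ℝ => c (Circle.exp a) := hcm.comp hem
  have hcen : Measurable fun a : ℝ => c (Circle.exp (-a)) := hcm.comp (hem.comp measurable_neg)
  have hκT : Measurable fun t : specialDiagonalTorus (Fin 2) => κ (t : Matrix.specialUnitaryGroup (Fin 2) ℂ) :=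
    hκm.comp measurable_subtype_coe
  have hH : Measurable fun t : specialDiagonalTorus (Fin 2) => D t * κ (t : Matrix.specialUnitaryGroup (Fin 2) ℂ) :=
    hDm.mul hκT
  -- chamber values
  have hDexp : ∀ a : ℝ, D (c (Circle.exp a)) = ENNReal.ofReal (2 * Real.sin a ^ 2) := fun a => by
    simp only [hD]
    rw [vandermondeWeight_su2TorusChart_exp hc]
  have hκneg : ∀ a : ℝ, κ ((c (Circle.exp (-a)) : specialDiagonalTorus (Fin 2)) :
      Matrix.specialUnitaryGroup (Fin 2) ℂ) =
      κ ((c (Circle.exp a) : specialDiagonalTorus (Fin 2)) : Matrix.specialUnitaryGroup (Fin 2) ℂ) := by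
    intro a
    simp only [hκ]
    rw [Circle.exp_neg, su2TorusChart_inv_eq_weyl_conj hc, conjMass_conj hA]
  -- Tonelli: integrate `g` first
  rw [Measure.map_apply hΦ hA, Measure.prod_apply_symm (hΦ hA)]
  change ∫⁻ t, μ {g : Matrix.specialUnitaryGroup (Fin 2) ℂ |
      g * (t : Matrix.specialUnitaryGroup (Fin 2) ℂ) * g⁻¹ ∈ A} ∂((haarProbability
        (specialDiagonalTorus (Fin 2))).withDensity D) = _
  rw [lintegral_withDensity_eq_lintegral_mul _ hDm hκT]
  change ∫⁻ t, D t * κ (t : Matrix.specialUnitaryGroup (Fin 2) ℂ) ∂(haarProbability (specialDiagonalTorus (Fin 2))) = _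
  -- the torus by chambers
  rw [haarProbability_su2Torus_eq_alcoves hc, lintegral_smul_measure, lintegral_add_measure,
    lintegral_map hH hce, lintegral_map hH hcen]
  have hI : ∀ s : ℝ → ℝ, (fun a : ℝ => D (c (Circle.exp (s a))) *
      κ ((c (Circle.exp (s a)) : specialDiagonalTorus (Fin 2)) : Matrix.specialUnitaryGroup (Fin 2) ℂ)) =
      fun a => ENNReal.ofReal (2 * Real.sin (s a) ^ 2) *
        κ ((c (Circle.exp (s a)) : specialDiagonalTorus (Fin 2)) : Matrix.specialUnitaryGroup (Fin 2) ℂ) :=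
    fun s => funext fun a => by rw [hDexp]
  rw [hI (fun a => a), hI (fun a => -a)]
  simp_rw [hκneg, Real.sin_neg, neg_sq]
  rw [← two_mul, smul_eq_mul, ← mul_assoc]
  have hmeas : Measurable fun a : ℝ => ENNReal.ofReal (2 * Real.sin a ^ 2) *
      κ ((c (Circle.exp a) : specialDiagonalTorus (Fin 2)) : Matrix.specialUnitaryGroup (Fin 2) ℂ) :=
    (ENNReal.measurable_ofReal.comp (by fun_prop : Measurable fun a : ℝ => 2 * Real.sin a ^ 2)).mul
      (hκT.comp hce)
  rw [← lintegral_const_mul _ hmeas]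
  refine lintegral_congr fun a => ?_
  rw [← mul_assoc]
  congr 1
  have h2π : (0 : ℝ) < 2 * π := by positivity
  rw [show (2 : ℝ≥0∞) = ENNReal.ofReal 2 from (ENNReal.ofReal_ofNat 2).symm, mul_assoc,
    ← ENNReal.ofReal_mul (by norm_num : (0 : ℝ) ≤ 2), mul_comm, ← div_eq_mul_inv,
    ← ENNReal.ofReal_div_of_pos h2π]
  congr 1
  field_simp

omit hc

/-- **Weyl's integral formula for `SU(2)` (Bröcker–tom Dieck IV (1.11), `G = SU(2)`, `T = SΔ(2)`,
`|W| = 2`), PROVED**: conjugation `(g, t) ↦ g t g⁻¹` pushes `Haar_{SU(2)} ⊗ (|Δ(t)|²/2)·Haar_{SΔ(2)}`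
forward to `Haar_{SU(2)}` — the tree's named fact `weylIntegralFormula_specialUnitary` at `n = Fin 2`. -/
theorem weylIntegralFormula_specialUnitary_fin_two : weylIntegralFormula_specialUnitary (Fin 2) := by
  obtain ⟨c, -, hc⟩ := exists_su2TorusChart
  unfold weylIntegralFormula_specialUnitary
  ext A hA
  rw [weylPushforward_apply_eq_lintegral_alcove hc hA, haar_apply_eq_lintegral_alcove hc hA]

end SU2

end Summit.Ventures.LatticeQCDFlow.Exactness
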